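import Literature.MathematicalPhysics.QuantumFieldTheory.Balaban1983to89.B9Eq324PenaltyKernelForm

/-!
# `Balaban1983to89.B9Eq342MajorantReadingSeam` — T. Bałaban, *Propagators for lattice gauge theories in a background field*, Commun. Math. Phys. **99** (1985)
# 389–434 [Balaban1985BackgroundPropagators] Thm 3.1 (3.42) p. 397 («for x ∈ Δ(y), y ∈ Λ_j, supp λ ⊂ Δ(y′)») with [Balaban1984PropagatorsII] (2.51)–(2.52) p. 232:
# **THE SEAM BETWEEN THE NE9 CHAIN's SUP ROWS AND THE SECT. B PROGRAMME's BLOCK MAJORANTS** — a block-sup row `‖(Tf)(x)‖ ≤ K(y_x, y′)·sup‖f‖` for sources `f`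
# supported in ONE block `y′` (the shape of the chain's `B9Eq342GreenPrimeTower*Row*` letters, values in the Hilbert fibre `W`) IS, after reading in `𝔸` along `φ`
# (`readA`) and realifying (`conj b`), r06's `B6RandomWalk.HasMajorant` with the kernel `M₂(Σ_i‖b_i‖)M_φM_φ′·K`, AND CONVERSELY — junction items (j2)∕(j4)∕(j6) of the NE9
# lineage's route memo `ROUTE-J-VIA-THM34-g98.md` (inputs `h342_*` of `B9Thm34SectBUniform(R1).thm34_Gp_uniform` from the chain's rows; its output majorants back to rows)

statement-level skeleton of published theorems with citation tags; proofs where landed; nothing here is a claim about the Yang–Mills mass gap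

CITATION HEADER (lean-in-tree rule).  Audit cell `pub-balaban`, sub-cell `t4`, BINDER row NE9; NE9 crux-team LEAF PROVER 01 (`b2b-balaban-t4-ne9-formalise-leaf-01`,
gen 99; bears_on: R4/N22).  Vocabulary BY NAME: `B6RandomWalk.HasMajorant` ∕ `BlockSupp` (pv08), r06's `B9Eq352DivFormLetters.coordEquiv` ∕ `conj` ∕ `conj_apply` ∕
`norm_coordSymm_apply_le` (the real-coordinate reading (2.51), whose LOCAL seams `hasMajorant_conj_of_local(′)` this file complements with the non-local, decaying one),
this lineage's `B9Eq324PenaltyKernelForm.readA` ∕ `readA_apply`, the chain's `B11Eq103H1Complex.SiteL2K` ∕ `B9Eq311L2Pairing.WL2`.  Sources read through those files'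
verbatim quotations: [Balaban1985BackgroundPropagators] p. 397 (3.42); [Balaban1984PropagatorsII] p. 232 (2.51) «|(G′₀(Γ_{y,y′})λ)(x)| ≦ … for x ∈ Δ(y), supp λ ⊂ Δ(y′)»,
(2.52).  [folklore] norm comparisons in finite dimension; NOTHING of print's estimates is asserted.

WHAT IS PROVED (sorry-free; proof lane — no `def`).
* §1 GENERIC (`E`-valued lattice functions, real basis `b` with `|b.repr v i| ≤ M₂‖v‖`, any `B6.Geometry`, block map `blk`):
  **`hasMajorant_conj_of_blockRow`** — a block-sup row with kernel `K` for `T : Module.End ℝ (S → E)` gives `conj b T ≺ M₂(Σ‖b_i‖)·K`;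
  **`blockRow_of_hasMajorant_conj`** — conversely `conj b T ≺ K` gives the block-sup row with kernel `(Σ‖b_i‖)M₂·K`.
* §2 THE FIBRE READING (`φ : W ≃ 𝔸`, `‖φw‖ ≤ M_φ‖w‖`, `‖φ⁻¹X‖ ≤ M_φ′‖X‖`): **`blockRowA_of_blockRowW`** — a `W`-valued row of an operator `T` of the chain's `L²` carrier (sources
  supported over one coarse site `v` of a block map `Π`, `‖f‖_∞ ≤ F`) gives the `𝔸`-valued row of `readA φ T` with kernel `M_φM_φ′·K`; **`blockRowW_of_blockRowA`** — conversely.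
* §3 THE SEAM: **`hasMajorant_conj_readA_of_blockRowW`** (`W`-row ⇒ `conj b (readA φ T) ≺ M₂(Σ‖b_i‖)M_φM_φ′·K`), **`blockRowW_of_hasMajorant_conj_readA`** (majorant ⇒ `W`-row with
  kernel `(Σ‖b_i‖)M₂M_φ′M_φ·K`).
HONEST SCOPE.  Bookkeeping; the constants `M₂, Σ‖b_i‖, M_φ, M_φ′` are fixed fibre data (lattice-free); no estimate of the paper; NE9 NOT PRINTED ∕ NOT PROVED; spine PROVED 0∕9;
rung (B)+1 finite T⁴ — NOT infinite volume, NOT mass gap, NOT BetaPertH, NOT Clay.  HONEST DEPENDENCY: continuum YM on T⁴ ⇐ BetaPertH ∧ nine spine estimates (0/9 proved);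
BetaPertH ⇐ (D1) ∧ (D4) ∧ CAP+tail; G-an2-4 gates asym, D1 and NE2/3/4.  NEW file; nothing modified.  Net new unproved facts: 0.
-/

noncomputable section

open scoped BigOperators

namespace Literature.MathematicalPhysics.QuantumFieldTheory.Balaban1983to89.B9Eq342MajorantReadingSeam

open B4Sect5Torus (TSite)
open B6RandomWalk (HasMajorant BlockSupp)
open B9Eq352DivFormLetters (coordEquiv coordEquiv_apply coordEquiv_symm_apply conj conj_apply norm_coordSymm_apply_le)
open B9Eq311L2Pairing (WL2)
open B11Eq103H1Complex (SiteL2K)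
open B9Eq324PenaltyKernelForm (readA readA_apply)

/-! ## §1 Block-sup rows of `E`-valued operators ⇄ block majorants of their real-coordinate conjugates -/

section Generic

variable {E : Type*} [NormedAddCommGroup E] [NormedSpace ℝ E] {ι : Type} [Fintype ι] (b : Module.Basis ι ℝ E) {S : Type}
  {G : B6.Geometry} (blk : S → G.Site) {M₂ : ℝ} (hM₂ : 0 ≤ M₂) (hrepr : ∀ (v : E) (i : ι), |b.repr v i| ≤ M₂ * ‖v‖)
include hM₂ hrepr

/-- **ROW ⇒ MAJORANT.**  If `T : Module.End ℝ (S → E)` has the block-sup row `‖(Tf)(x)‖ ≤ K(y_x, y′)·B` for every `f` supported in the block `y′` with `‖f‖ ≤ B` there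
(the shape of (3.42) «for x ∈ Δ(y), supp λ ⊂ Δ(y′)»), then its real-coordinate conjugate has the block majorant `M₂(Σ_i‖b_i‖)·K` ((2.51)).
[cite: Balaban1985BackgroundPropagators, Thm 3.1 (3.42) p.397; Balaban1984PropagatorsII, (2.51) p.232] -/
theorem hasMajorant_conj_of_blockRow (T : Module.End ℝ (S → E)) (K : G.Site → G.Site → ℝ)
    (hT : ∀ (y' : G.Site) (f : S → E) (B : ℝ), 0 ≤ B → (∀ x, blk x ≠ y' → f x = 0) → (∀ x, blk x = y' → ‖f x‖ ≤ B) →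
      ∀ x, ‖T f x‖ ≤ K (blk x) y' * B) :
    HasMajorant (g := G) (fun p : S × ι => blk p.1) (conj b T) (fun a a' => M₂ * (∑ i, ‖b i‖) * K a a') := by
  have hSb : 0 ≤ ∑ i, ‖b i‖ := Finset.sum_nonneg fun i _ => norm_nonneg _
  intro y' μ B hμ p
  have hoff : ∀ x, blk x ≠ y' → (coordEquiv b).symm μ x = 0 := fun x hx => by
    rw [coordEquiv_symm_apply]
    exact Finset.sum_eq_zero fun i _ => by rw [hμ.off (x, i) hx, zero_smul]
  have hbd : ∀ x, blk x = y' → ‖(coordEquiv b).symm μ x‖ ≤ (∑ i, ‖b i‖) * B := fun x hx =>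
    norm_coordSymm_apply_le b μ x B fun i => hμ.bound (x, i) hx
  have h1 := hT y' ((coordEquiv b).symm μ) ((∑ i, ‖b i‖) * B) (mul_nonneg hSb hμ.nonneg) hoff hbd p.1
  rw [conj_apply]
  calc |b.repr (T ((coordEquiv b).symm μ) p.1) p.2| ≤ M₂ * ‖T ((coordEquiv b).symm μ) p.1‖ := hrepr _ _
    _ ≤ M₂ * (K (blk p.1) y' * ((∑ i, ‖b i‖) * B)) := mul_le_mul_of_nonneg_left h1 hM₂
    _ = M₂ * (∑ i, ‖b i‖) * K (blk p.1) y' * B := by ring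

/-- **MAJORANT ⇒ ROW.**  Conversely, a block majorant `conj b T ≺ K` (`K ≥ 0`) gives back the block-sup row of `T` with kernel `(Σ_i‖b_i‖)M₂·K`
(`‖v‖ = ‖Σ_i (b.repr v)_i b_i‖ ≤ Σ_i |(b.repr v)_i|‖b_i‖`). [cite: Balaban1985BackgroundPropagators, Thm 3.1 (3.42) p.397; Balaban1984PropagatorsII, (2.51) p.232] -/
theorem blockRow_of_hasMajorant_conj (T : Module.End ℝ (S → E)) (K : G.Site → G.Site → ℝ)
    (hT : HasMajorant (g := G) (fun p : S × ι => blk p.1) (conj b T) K)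
    (y' : G.Site) (f : S → E) (B : ℝ) (hB : 0 ≤ B) (hoff : ∀ x, blk x ≠ y' → f x = 0) (hbd : ∀ x, blk x = y' → ‖f x‖ ≤ B) (x : S) :
    ‖T f x‖ ≤ (∑ i, ‖b i‖) * M₂ * K (blk x) y' * B := by
  have hμ : BlockSupp (g := G) (fun p : S × ι => blk p.1) (coordEquiv b f) y' (M₂ * B) :=
    ⟨mul_nonneg hM₂ hB, fun p hp => by rw [coordEquiv_apply]; exact (hrepr _ _).trans (mul_le_mul_of_nonneg_left (hbd p.1 hp) hM₂),
      fun p hp => by rw [coordEquiv_apply, hoff p.1 hp, map_zero, Finsupp.zero_apply]⟩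
  have h1 : ∀ i, |b.repr (T f x) i| ≤ K (blk x) y' * (M₂ * B) := fun i => by
    have h := hT y' (coordEquiv b f) (M₂ * B) hμ (x, i)
    rwa [conj_apply, LinearEquiv.symm_apply_apply] at h
  calc ‖T f x‖ = ‖∑ i, b.repr (T f x) i • b i‖ := by rw [Module.Basis.sum_repr]
    _ ≤ ∑ i, ‖b.repr (T f x) i • b i‖ := norm_sum_le _ _
    _ ≤ ∑ i, ‖b i‖ * (K (blk x) y' * (M₂ * B)) := Finset.sum_le_sum fun i _ => by
        rw [norm_smul, Real.norm_eq_abs, mul_comm]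
        exact mul_le_mul_of_nonneg_left (h1 i) (norm_nonneg _)
    _ = (∑ i, ‖b i‖) * M₂ * K (blk x) y' * B := by rw [← Finset.sum_mul]; ring

end Generic

/-! ## §2 The fibre reading: `W`-valued rows of the chain ⇄ `𝔸`-valued rows of `readA` -/

section Fibre

variable {d : ℕ} {P : Fin d → ℕ} {𝔸 : Type*} [NormedRing 𝔸] [NormedAlgebra ℂ 𝔸] {W : Type*} [NormedAddCommGroup W] [InnerProductSpace ℂ W]
  (φ : W ≃ₗ[ℂ] 𝔸) {c₀ : ℝ} {Mφ Mφ' : ℝ} (hMφ : 0 ≤ Mφ) (hMφ' : 0 ≤ Mφ') (hφ : ∀ w, ‖φ w‖ ≤ Mφ * ‖w‖) (hφ' : ∀ X, ‖φ.symm X‖ ≤ Mφ' * ‖X‖)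
  {Y : Type*} (bm : TSite d P → Y)
include hMφ hMφ' hφ hφ'

/-- **`W`-ROW ⇒ `𝔸`-ROW.**  A block-sup row of an operator `T` of the `L²` gauge parameters — for every coarse site `v`, every source `f` vanishing off `Π⁻¹(v)` with
`‖f(y)‖_W ≤ F` everywhere, `‖(Tf)(x)‖_W ≤ K(Πx, v)·F` (the chain's `B9Eq342GreenPrimeTower*Row*` shape) — gives the row of `readA φ T` on `𝔸`-valued functions with kernel
`M_φM_φ′·K`. [cite: Balaban1985BackgroundPropagators, Thm 3.1 (3.42) p.397, (3.11) p.392] -/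
theorem blockRowA_of_blockRowW (T : SiteL2K ℂ d P c₀ W →ₗ[ℂ] SiteL2K ℂ d P c₀ W) (K : Y → Y → ℝ)
    (hT : ∀ (v : Y) (f : SiteL2K ℂ d P c₀ W) (F : ℝ), (∀ x, bm x ≠ v → WL2.equiv ℂ (fun _ : TSite d P => c₀) W f x = 0) →
      (∀ y, ‖WL2.equiv ℂ (fun _ : TSite d P => c₀) W f y‖ ≤ F) → ∀ x, ‖WL2.equiv ℂ (fun _ : TSite d P => c₀) W (T f) x‖ ≤ K (bm x) v * F)
    (v : Y) (g : TSite d P → 𝔸) (B : ℝ) (hB : 0 ≤ B) (hoff : ∀ x, bm x ≠ v → g x = 0) (hbd : ∀ x, bm x = v → ‖g x‖ ≤ B) (x : TSite d P) :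
    ‖readA φ T g x‖ ≤ Mφ * Mφ' * K (bm x) v * B := by
  set f : SiteL2K ℂ d P c₀ W := (WL2.equiv ℂ (fun _ : TSite d P => c₀) W).symm fun z => φ.symm (g z) with hf
  have hfoff : ∀ z, bm z ≠ v → WL2.equiv ℂ (fun _ : TSite d P => c₀) W f z = 0 := fun z hz => by
    rw [hf, Equiv.apply_symm_apply, hoff z hz, map_zero]
  have hfbd : ∀ y, ‖WL2.equiv ℂ (fun _ : TSite d P => c₀) W f y‖ ≤ Mφ' * B := fun y => by
    rw [hf, Equiv.apply_symm_apply]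
    by_cases hy : bm y = v
    · exact (hφ' _).trans (mul_le_mul_of_nonneg_left (hbd y hy) hMφ')
    · rw [hoff y hy, map_zero, norm_zero]; positivity
  have h1 := hT v f (Mφ' * B) hfoff hfbd x
  rw [readA_apply]
  calc ‖φ (WL2.equiv ℂ (fun _ : TSite d P => c₀) W (T f) x)‖ ≤ Mφ * ‖WL2.equiv ℂ (fun _ : TSite d P => c₀) W (T f) x‖ := hφ _
    _ ≤ Mφ * (K (bm x) v * (Mφ' * B)) := mul_le_mul_of_nonneg_left h1 hMφ
    _ = Mφ * Mφ' * K (bm x) v * B := by ring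

/-- **`𝔸`-ROW ⇒ `W`-ROW.**  Conversely, a block-sup row of `readA φ T` with kernel `K ≥ 0` (sources vanishing off `Π⁻¹(v)`, bounded by `B` on it) gives the `W`-valued row of `T`
with kernel `M_φ′M_φ·K`. [cite: Balaban1985BackgroundPropagators, Thm 3.1 (3.42) p.397, (3.11) p.392] -/
theorem blockRowW_of_blockRowA (T : SiteL2K ℂ d P c₀ W →ₗ[ℂ] SiteL2K ℂ d P c₀ W) (K : Y → Y → ℝ)
    (hT : ∀ (v : Y) (g : TSite d P → 𝔸) (B : ℝ), 0 ≤ B → (∀ x, bm x ≠ v → g x = 0) → (∀ x, bm x = v → ‖g x‖ ≤ B) →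
      ∀ x, ‖readA φ T g x‖ ≤ K (bm x) v * B)
    (v : Y) (f : SiteL2K ℂ d P c₀ W) (F : ℝ) (hF : 0 ≤ F) (hoff : ∀ x, bm x ≠ v → WL2.equiv ℂ (fun _ : TSite d P => c₀) W f x = 0)
    (hbd : ∀ x, bm x = v → ‖WL2.equiv ℂ (fun _ : TSite d P => c₀) W f x‖ ≤ F) (x : TSite d P) :
    ‖WL2.equiv ℂ (fun _ : TSite d P => c₀) W (T f) x‖ ≤ Mφ' * Mφ * K (bm x) v * F := by
  set g : TSite d P → 𝔸 := fun z => φ (WL2.equiv ℂ (fun _ : TSite d P => c₀) W f z) with hg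
  have hgoff : ∀ z, bm z ≠ v → g z = 0 := fun z hz => by rw [hg]; simp only [hoff z hz, map_zero]
  have hgbd : ∀ z, bm z = v → ‖g z‖ ≤ Mφ * F := fun z hz => (hφ _).trans (mul_le_mul_of_nonneg_left (hbd z hz) hMφ)
  have h1 := hT v g (Mφ * F) (mul_nonneg hMφ hF) hgoff hgbd x
  have hfg : ((WL2.equiv ℂ (fun _ : TSite d P => c₀) W).symm fun z => φ.symm (g z)) = f := by
    apply (WL2.equiv ℂ (fun _ : TSite d P => c₀) W).injective
    funext z
    rw [Equiv.apply_symm_apply, hg, LinearEquiv.symm_apply_apply]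
  have hread : readA φ T g x = φ (WL2.equiv ℂ (fun _ : TSite d P => c₀) W (T f) x) := by
    rw [readA_apply, hfg]
  calc ‖WL2.equiv ℂ (fun _ : TSite d P => c₀) W (T f) x‖ = ‖φ.symm (φ (WL2.equiv ℂ (fun _ : TSite d P => c₀) W (T f) x))‖ := by
        rw [LinearEquiv.symm_apply_apply]
    _ ≤ Mφ' * ‖φ (WL2.equiv ℂ (fun _ : TSite d P => c₀) W (T f) x)‖ := hφ' _
    _ = Mφ' * ‖readA φ T g x‖ := by rw [hread]
    _ ≤ Mφ' * (K (bm x) v * (Mφ * F)) := mul_le_mul_of_nonneg_left h1 hMφ'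
    _ = Mφ' * Mφ * K (bm x) v * F := by ring

end Fibre

/-! ## §3 The seam: `W`-rows of the chain ⇄ `HasMajorant` of `conj b (readA φ T)` -/

section Seam

variable {d : ℕ} {P : Fin d → ℕ} {𝔸 : Type*} [NormedRing 𝔸] [NormedAlgebra ℂ 𝔸] {W : Type*} [NormedAddCommGroup W] [InnerProductSpace ℂ W]
  (φ : W ≃ₗ[ℂ] 𝔸) {c₀ : ℝ} {Mφ Mφ' : ℝ} (hMφ : 0 ≤ Mφ) (hMφ' : 0 ≤ Mφ') (hφ : ∀ w, ‖φ w‖ ≤ Mφ * ‖w‖) (hφ' : ∀ X, ‖φ.symm X‖ ≤ Mφ' * ‖X‖)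
  {ι : Type} [Fintype ι] (b : Module.Basis ι ℝ 𝔸) {M₂ : ℝ} (hM₂ : 0 ≤ M₂) (hrepr : ∀ (v : 𝔸) (i : ι), |b.repr v i| ≤ M₂ * ‖v‖)
  {G : B6.Geometry} (bm : TSite d P → G.Site)
include hMφ hMφ' hφ hφ' hM₂ hrepr

/-- **THE SEAM, INPUT DIRECTION: a `W`-valued block-sup row of the chain IS a block majorant of the Sect. B programme** — `conj b (readA φ T) ≺ M₂(Σ_i‖b_i‖)M_φM_φ′·K` with
respect to the block map `(x, i) ↦ bm x` (the `h342_*` hypotheses of `B9Thm34SectBUniform(R1).thm34_Gp_uniform` from the chain's `B9Eq342GreenPrimeTower*Row*` letters).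
[cite: Balaban1985BackgroundPropagators, Thm 3.1 (3.42) p.397; Balaban1984PropagatorsII, (2.51) p.232] -/
theorem hasMajorant_conj_readA_of_blockRowW (T : SiteL2K ℂ d P c₀ W →ₗ[ℂ] SiteL2K ℂ d P c₀ W) (K : G.Site → G.Site → ℝ)
    (hT : ∀ (v : G.Site) (f : SiteL2K ℂ d P c₀ W) (F : ℝ), (∀ x, bm x ≠ v → WL2.equiv ℂ (fun _ : TSite d P => c₀) W f x = 0) →
      (∀ y, ‖WL2.equiv ℂ (fun _ : TSite d P => c₀) W f y‖ ≤ F) → ∀ x, ‖WL2.equiv ℂ (fun _ : TSite d P => c₀) W (T f) x‖ ≤ K (bm x) v * F) :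
    HasMajorant (g := G) (fun p : TSite d P × ι => bm p.1) (conj b (readA φ T)) (fun a a' => M₂ * (∑ i, ‖b i‖) * (Mφ * Mφ' * K a a')) :=
  hasMajorant_conj_of_blockRow b bm hM₂ hrepr (readA φ T) (fun a a' => Mφ * Mφ' * K a a') fun v g B hB hoff hbd x =>
    blockRowA_of_blockRowW φ hMφ hMφ' hφ hφ' bm T K hT v g B hB hoff hbd x

/-- **THE SEAM, OUTPUT DIRECTION: a block majorant of the Sect. B programme IS a `W`-valued block-sup row of the chain** — `conj b (readA φ T) ≺ K` (`K ≥ 0`) gives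
`‖(Tf)(x)‖_W ≤ (Σ_i‖b_i‖)M₂M_φ′M_φ·K(Πx, v)·F` for `f` vanishing off `Π⁻¹(v)` with `‖f‖ ≤ F` there (the read-back of `thm34_Gp_uniform`'s output majorants into the chain's currency).
[cite: Balaban1985BackgroundPropagators, Thm 3.1 (3.42) p.397; Balaban1984PropagatorsII, (2.51) p.232] -/
theorem blockRowW_of_hasMajorant_conj_readA (T : SiteL2K ℂ d P c₀ W →ₗ[ℂ] SiteL2K ℂ d P c₀ W) (K : G.Site → G.Site → ℝ)
    (hT : HasMajorant (g := G) (fun p : TSite d P × ι => bm p.1) (conj b (readA φ T)) K)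
    (v : G.Site) (f : SiteL2K ℂ d P c₀ W) (F : ℝ) (hF : 0 ≤ F) (hoff : ∀ x, bm x ≠ v → WL2.equiv ℂ (fun _ : TSite d P => c₀) W f x = 0)
    (hbd : ∀ x, bm x = v → ‖WL2.equiv ℂ (fun _ : TSite d P => c₀) W f x‖ ≤ F) (x : TSite d P) :
    ‖WL2.equiv ℂ (fun _ : TSite d P => c₀) W (T f) x‖ ≤ Mφ' * Mφ * ((∑ i, ‖b i‖) * M₂ * K (bm x) v) * F := by
  refine blockRowW_of_blockRowA φ hMφ hMφ' hφ hφ' bm T (fun a a' => (∑ i, ‖b i‖) * M₂ * K a a')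
    (fun v g B hB hoff hbd x => ?_) v f F hF hoff hbd x
  exact blockRow_of_hasMajorant_conj b bm hM₂ hrepr (readA φ T) K hT v g B hB hoff hbd x

end Seam

end Literature.MathematicalPhysics.QuantumFieldTheory.Balaban1983to89.B9Eq342MajorantReadingSeam

end
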